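import Summits.Ventures.PercRepro.S1DisjointSumFiveFourProfile

/-!
# PercRepro — THE TWO PROFILES OF THE `(3, 6)` SPLIT: A COLOOP-FREE RANK-6 PART ON 8 POINTS AND A COLOOP-FREE
SIMPLE RANK-3 PART ON 6 POINTS (p2, gen 28; SUBCLAIM-S1 §6.10 (xvii)(j))

What the `(3, 6)`-split consumer (`S1DisjointSumThreeSix`) needs. For the rank-`6` part `N` on `8` points:
`ρ(E) ≤ ρ(X) + |E ∖ X|` (so every `5`-set has rank `3 … 5` and every `4`-set rank `≥ 2`), no `4`-point line when
`N` is coloop-free (a point outside would be a coloop), hence `f(3) + f(4) + f(5) ≥ 56 + 70 = 126`; every `7`-set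
spans when `N` is coloop-free, so `f(6) ≥ 9`; `f(2) ≥ 28`. For the rank-`3` part `M` on `6` points with all pairs of
rank `2`: the rank-`2` `3`-sets number at most `10` (each of the `15` pairs lies in at most `2` of them: the closure of
a pair has at most `4` points when `M` is coloop-free), so `N_M(3, 2) ≤ 15 + 10 = 25`; `f(2) + f(3) ≥ 57`; and with
the coloop-free double count `2 f(2) ≤ 3 f(3)`, `f(3) ≥ 23`. Nothing is claimed about any cell.

* `eRank_le_eRk_add_ncard_sdiff` — `ρ(E) ≤ ρ(X) + |E ∖ X|`;
* `two_le_eRk_of_ncard_eq_four_of_coloops` (no `4`-point line), `ncard_rankSet_sum_ge_three_five`, `nine_le_ncard_rankSet_six`,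
  `choose_le_ncard_rankSet_two_of_pairs` — the `N`-side;
* `ncard_closure_pair_le_four_of_coloops`, `ncard_rank_two_triples_le_ten`, `ncard_profileSet_three_two_le_of_pairs'`,
  `ncard_rankSet_two_add_three_ge_of_pairs`, `ncard_rankSet_three_ge_of_pairs` — the `M`-side.
Axioms: standard.
-/

open scoped Matroid

namespace PercRepro

namespace S1

open Set

variable {α : Type}

/-- `ρ(E) ≤ ρ(X) + |E ∖ X|` for `X ⊆ E`. -/
theorem eRank_le_eRk_add_ncard_sdiff (M : Matroid α) [M.Finite] {X : Set α} (hX : X ⊆ M.E) :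
    M.eRank ≤ M.eRk X + ((M.E \ X).ncard : ℕ∞) := by
  have h1 := M.eRk_union_le_eRk_add_eRk X (M.E \ X)
  rw [union_sdiff_cancel hX, M.eRk_ground] at h1
  have h2 : M.eRk (M.E \ X) ≤ ((M.E \ X).ncard : ℕ∞) := by
    rw [(M.ground_finite.subset sdiff_subset).cast_ncard_eq]
    exact M.eRk_le_encard _
  exact h1.trans (add_le_add (le_refl _) h2)

section RankSixOnEight

variable {N : Matroid α} [N.Finite]

/-- In a coloop-free matroid of rank `6` on `8` points no `4`-set has rank `≤ 2`: its complement would have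
`ρ(E ∖ x) ≤ 2 + 3 = 5` for every outside point `x`, making `x` a coloop. -/
theorem three_le_eRk_of_ncard_eq_four_of_coloops (hN : N.eRank = ((6 : ℕ) : ℕ∞)) (hE : N.E.ncard = 8)
    (hcol : N.coloops = ∅) {X : Set α} (hX : X ⊆ N.E) (h4 : X.ncard = 4) : 3 ≤ N.eRk X := by
  by_contra hlt
  push Not at hlt
  have hX2 : N.eRk X ≤ 2 := by
    obtain ⟨n, hn⟩ := ENat.ne_top_iff_exists.mp (ne_top_of_lt hlt)
    rw [← hn] at hlt ⊢
    have h' : n < 3 := by exact_mod_cast hlt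
    exact_mod_cast (show n ≤ 2 by omega)
  have hXfin : X.Finite := N.ground_finite.subset hX
  -- pick a point outside `X`
  have hne : (N.E \ X).Nonempty := by
    rw [← ncard_pos (N.ground_finite.subset sdiff_subset), ncard_sdiff' hX N.ground_finite, hE, h4]
    norm_num
  obtain ⟨x, hx⟩ := hne
  -- `ρ(E ∖ {x}) ≤ ρ(X) + |E ∖ {x} ∖ X| ≤ 2 + 3`
  have hsub : X ⊆ N.E \ {x} := fun y hy => ⟨hX hy, fun hyx => hx.2 (by rw [mem_singleton_iff] at hyx; rw [← hyx]; exact hy)⟩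
  have h1 := N.eRk_union_le_eRk_add_eRk X ((N.E \ {x}) \ X)
  rw [union_sdiff_cancel hsub] at h1
  have h2 : N.eRk ((N.E \ {x}) \ X) ≤ 3 := by
    have hc : ((N.E \ {x}) \ X).ncard = 3 := by
      rw [ncard_sdiff' hsub (N.ground_finite.subset sdiff_subset), ncard_sdiff_singleton_of_mem hx.1, hE, h4]
    have := N.eRk_le_encard ((N.E \ {x}) \ X)
    rw [← (N.ground_finite.subset (sdiff_subset.trans sdiff_subset)).cast_ncard_eq, hc] at this
    exact this
  have h3 : N.eRk (N.E \ {x}) ≤ 5 := by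
    calc N.eRk (N.E \ {x}) ≤ N.eRk X + N.eRk ((N.E \ {x}) \ X) := h1
      _ ≤ 2 + 3 := add_le_add hX2 h2
      _ = 5 := by norm_num
  -- so `x` is a coloop
  have hcolx : N.IsColoop x := by
    rw [Matroid.isColoop_iff_notMem_closure_compl hx.1, mem_closure_iff_eRk_insert_eq N hx.1 sdiff_subset,
      insert_sdiff_self_of_mem hx.1, N.eRk_ground, hN]
    intro heq
    rw [← heq] at h3
    exact absurd h3 (by decide)
  have hmem : x ∈ N.coloops := hcolx
  rw [hcol] at hmem
  exact hmem

/-- `f(3) + f(4) + f(5) ≥ 126` for a coloop-free matroid of rank `6` on `8` points: every `5`-set has rank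
`3 … 5` (`ρ(E) ≤ ρ(X) + 3`) and every `4`-set rank `3` or `4`. -/
theorem ncard_rankSet_sum_ge_three_five (hN : N.eRank = ((6 : ℕ) : ℕ∞)) (hE : N.E.ncard = 8)
    (hcol : N.coloops = ∅) :
    126 ≤ (rankSet N 3).ncard + (rankSet N 4).ncard + (rankSet N 5).ncard := by
  have hfin5 : {A : Set α | A ⊆ N.E ∧ A.ncard = 5}.Finite := N.ground_finite.finite_subsets.subset (fun _ hA => hA.1)
  have hfin4 : {A : Set α | A ⊆ N.E ∧ A.ncard = 4}.Finite := N.ground_finite.finite_subsets.subset (fun _ hA => hA.1)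
  have hsub : {A : Set α | A ⊆ N.E ∧ A.ncard = 5} ∪ {A : Set α | A ⊆ N.E ∧ A.ncard = 4} ⊆
      rankSet N 3 ∪ rankSet N 4 ∪ rankSet N 5 := by
    rintro A (⟨hAE, h5⟩ | ⟨hAE, h4⟩)
    · have hAfin : A.Finite := N.ground_finite.subset hAE
      have hhi : N.eRk A ≤ 5 := by
        have := N.eRk_le_encard A
        rwa [← hAfin.cast_ncard_eq, h5] at this
      have hlo : 3 ≤ N.eRk A := by
        have h := eRank_le_eRk_add_ncard_sdiff N hAE
        rw [hN, ncard_sdiff' hAE N.ground_finite, hE, h5] at h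
        have hfin : N.eRk A ≠ ⊤ := ne_top_of_le_ne_top (by decide) hhi
        obtain ⟨n, hn⟩ := ENat.ne_top_iff_exists.mp hfin
        rw [← hn] at h ⊢
        have h' : 6 ≤ n + (8 - 5) := by exact_mod_cast h
        exact_mod_cast (show 3 ≤ n by omega)
      obtain ⟨n, hn⟩ := ENat.ne_top_iff_exists.mp (ne_top_of_le_ne_top (by decide) hhi)
      rw [← hn] at hlo hhi
      have hlo' : 3 ≤ n := by exact_mod_cast hlo
      have hhi' : n ≤ 5 := by exact_mod_cast hhi
      have hmem : ∀ k, n = k → A ∈ rankSet N k := fun k hk => ⟨hAE, by rw [← hn, hk]⟩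
      rcases Nat.lt_or_ge n 4 with h | h
      · exact Or.inl (Or.inl (hmem 3 (by omega)))
      rcases Nat.lt_or_ge n 5 with h' | h'
      · exact Or.inl (Or.inr (hmem 4 (by omega)))
      · exact Or.inr (hmem 5 (by omega))
    · have hAfin : A.Finite := N.ground_finite.subset hAE
      have hhi : N.eRk A ≤ 4 := by
        have := N.eRk_le_encard A
        rwa [← hAfin.cast_ncard_eq, h4] at this
      have hlo := three_le_eRk_of_ncard_eq_four_of_coloops hN hE hcol hAE h4
      obtain ⟨n, hn⟩ := ENat.ne_top_iff_exists.mp (ne_top_of_le_ne_top (by decide) hhi)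
      rw [← hn] at hlo hhi
      have hlo' : 3 ≤ n := by exact_mod_cast hlo
      have hhi' : n ≤ 4 := by exact_mod_cast hhi
      have hmem : ∀ k, n = k → A ∈ rankSet N k := fun k hk => ⟨hAE, by rw [← hn, hk]⟩
      rcases Nat.lt_or_ge n 4 with h | h
      · exact Or.inl (Or.inl (hmem 3 (by omega)))
      · exact Or.inl (Or.inr (hmem 4 (by omega)))
  have hdisj : Disjoint {A : Set α | A ⊆ N.E ∧ A.ncard = 5} {A : Set α | A ⊆ N.E ∧ A.ncard = 4} := by
    rw [Set.disjoint_left]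
    rintro A ⟨-, h5⟩ ⟨-, h4⟩
    omega
  have h := ncard_le_ncard hsub (((rankSet_finite N 3).union (rankSet_finite N 4)).union (rankSet_finite N 5))
  rw [ncard_union_eq hdisj hfin5 hfin4, ncard_setOf_subset_ncard_eq N.ground_finite 5,
    ncard_setOf_subset_ncard_eq N.ground_finite 4, hE,
    ncard_union_eq (Set.disjoint_union_left.mpr
      ⟨rankSet_disjoint_of_ne N (by norm_num), rankSet_disjoint_of_ne N (by norm_num)⟩)
      ((rankSet_finite N 3).union (rankSet_finite N 4)) (rankSet_finite N 5),
    ncard_union_eq (rankSet_disjoint_of_ne N (by norm_num)) (rankSet_finite N 3) (rankSet_finite N 4)] at h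
  have h8 : Nat.choose 8 5 + Nat.choose 8 4 = 126 := by decide
  omega

/-- `f(6) ≥ 9` for a coloop-free matroid of rank `6` on `8` points: the ground set and its `8` seven-subsets all
span. -/
theorem nine_le_ncard_rankSet_six (hN : N.eRank = ((6 : ℕ) : ℕ∞)) (hE : N.E.ncard = 8) (hcol : N.coloops = ∅) :
    9 ≤ (rankSet N 6).ncard := by
  have hE6 : N.E ∈ rankSet N 6 := ⟨subset_rfl, by rw [N.eRk_ground, hN]⟩
  have hsub : insert N.E ((fun x => N.E \ {x}) '' N.E) ⊆ rankSet N 6 := by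
    rintro A (rfl | ⟨x, hx, rfl⟩)
    · exact hE6
    · refine ⟨sdiff_subset, ?_⟩
      have hcolx : ¬ N.IsColoop x := fun h => by
        have hmem : x ∈ N.coloops := h
        rw [hcol] at hmem
        exact hmem
      rw [Matroid.isColoop_iff_notMem_closure_compl hx, not_not,
        mem_closure_iff_eRk_insert_eq N hx sdiff_subset, insert_sdiff_self_of_mem hx, N.eRk_ground, hN] at hcolx
      exact hcolx.symm
  have hnot : N.E ∉ (fun x => N.E \ {x}) '' N.E := by
    rintro ⟨x, hx, hxE⟩
    have hxE' : N.E \ {x} = N.E := hxE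
    have : x ∈ N.E \ {x} := by rw [hxE']; exact hx
    exact this.2 rfl
  have himg : ((fun x => N.E \ {x}) '' N.E).ncard = 8 := by
    rw [InjOn.ncard_image, hE]
    intro x hx y hy hxy
    have hxy' : N.E \ {x} = N.E \ {y} := hxy
    by_contra hne
    have : y ∈ N.E \ {x} := ⟨hy, fun h => hne (by rw [mem_singleton_iff] at h; exact h.symm)⟩
    rw [hxy'] at this
    exact this.2 rfl
  have h := ncard_le_ncard hsub (rankSet_finite N 6)
  rwa [ncard_insert_of_notMem hnot (N.ground_finite.image _), himg] at h

/-- `f(2) ≥ C(|E|, 2)` when all pairs of distinct points have rank `2`. -/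
theorem choose_le_ncard_rankSet_two_of_pairs (hpairs : ∀ e ∈ N.E, ∀ f ∈ N.E, e ≠ f → N.eRk {e, f} = 2) :
    Nat.choose N.E.ncard 2 ≤ (rankSet N 2).ncard := by
  have hsub : {A : Set α | A ⊆ N.E ∧ A.ncard = 2} ⊆ rankSet N 2 := by
    rintro A ⟨hAE, hA2⟩
    obtain ⟨x, y, hxy, rfl⟩ := ncard_eq_two.mp hA2
    exact ⟨hAE, by rw [hpairs x (hAE (by simp)) y (hAE (by simp)) hxy]; rfl⟩
  have h := ncard_le_ncard hsub (rankSet_finite N 2)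
  rwa [ncard_setOf_subset_ncard_eq N.ground_finite 2] at h

end RankSixOnEight


section RankThreeOnSix

variable {M : Matroid α} [M.Finite]

/-- The rank-`2` `3`-subsets of `E`. -/
def rankTwoTriples (M : Matroid α) : Set (Set α) :=
  {T : Set α | T ⊆ M.E ∧ T.ncard = 3 ∧ M.eRk T = 2}

/-- The incidences «a rank-`2` triple with one of its pairs». -/
def triplePairs (M : Matroid α) : Set (Set α × Set α) :=
  {Q : Set α × Set α | Q.1 ∈ rankTwoTriples M ∧ Q.2 ⊆ Q.1 ∧ Q.2.ncard = 2}

/-- The rank-`2` triples form a finite set. -/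
theorem rankTwoTriples_finite (M : Matroid α) [M.Finite] : (rankTwoTriples M).Finite :=
  M.ground_finite.finite_subsets.subset (fun _ hT => hT.1)

/-- The closure of a pair of distinct points has at most `|E| − 2` points in a coloop-free matroid of rank `3`
(`S1RankProfileDoubleCount`: a rank-`2` set misses at least two points of its closure's complement). -/
theorem ncard_closure_pair_le_of_coloops (hM : M.eRank = ((3 : ℕ) : ℕ∞)) (hcol : M.coloops = ∅)
    (hpairs : ∀ e ∈ M.E, ∀ f ∈ M.E, e ≠ f → M.eRk {e, f} = 2) {x y : α} (hx : x ∈ M.E) (hy : y ∈ M.E)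
    (hxy : x ≠ y) : (M.closure {x, y}).ncard + 2 ≤ M.E.ncard := by
  have hM' : M.eRank = ((2 + 1 : ℕ) : ℕ∞) := hM
  have hA : ({x, y} : Set α) ∈ rankSet M 2 := by
    refine ⟨?_, by rw [hpairs x hx y hy hxy]; rfl⟩
    intro z hz
    rcases hz with rfl | rfl
    · exact hx
    · exact hy
  have h2 := two_le_ncard_ground_sdiff_closure M hM' hcol hA
  have hsub : M.closure {x, y} ⊆ M.E := M.closure_subset_ground _
  have h3 := ncard_sdiff_add_ncard_of_subset hsub M.ground_finite
  omega

/-- **At most `2 · C(|E|, 2) / 3` rank-`2` triples**: the incidences «triple ∋ pair» number `3 · #triples` and at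
most `2` per pair (the third point lies in the closure of the pair, which has at most `|E| − 2` points);
on `6` points, at most `10`. -/
theorem three_mul_ncard_rankTwoTriples_le (hM : M.eRank = ((3 : ℕ) : ℕ∞)) (hcol : M.coloops = ∅)
    (hpairs : ∀ e ∈ M.E, ∀ f ∈ M.E, e ≠ f → M.eRk {e, f} = 2) (hE : M.E.ncard = 6) :
    3 * (rankTwoTriples M).ncard ≤ 2 * 15 := by
  have hTfin := rankTwoTriples_finite M
  have hQfin : (triplePairs M).Finite :=
    (M.ground_finite.finite_subsets.prod M.ground_finite.finite_subsets).subset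
      (fun Q hQ => ⟨hQ.1.1, hQ.2.1.trans hQ.1.1⟩)
  -- lower side: the incidences are `⋃_T {T} × (2-subsets of T)`, `3` per triple
  have heq : triplePairs M = ⋃ T ∈ rankTwoTriples M, ({T} ×ˢ {P : Set α | P ⊆ T ∧ P.ncard = 2} : Set (Set α × Set α)) := by
    ext ⟨T, P⟩
    simp only [triplePairs, mem_setOf_eq, mem_iUnion, mem_prod, mem_singleton_iff, exists_prop]
    constructor
    · rintro ⟨hT, hPT, hP2⟩
      exact ⟨T, hT, rfl, hPT, hP2⟩
    · rintro ⟨T', hT', rfl, hPT, hP2⟩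
      exact ⟨hT', hPT, hP2⟩
  have hfib : ∀ T ∈ rankTwoTriples M, (({T} ×ˢ {P : Set α | P ⊆ T ∧ P.ncard = 2} : Set (Set α × Set α))).Finite :=
    fun T hT => (finite_singleton T).prod ((M.ground_finite.subset hT.1).finite_subsets.subset (fun _ hP => hP.1))
  have hdisj : (rankTwoTriples M).PairwiseDisjoint
      (fun T : Set α => ({T} ×ˢ {P : Set α | P ⊆ T ∧ P.ncard = 2} : Set (Set α × Set α))) := by
    intro T _ T' _ hTT
    rw [Function.onFun, Set.disjoint_left]
    rintro ⟨C, P⟩ ⟨hC1, -⟩ ⟨hC2, -⟩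
    apply hTT
    rw [mem_singleton_iff] at hC1 hC2
    rw [← hC1, ← hC2]
  have hlow : 3 * (rankTwoTriples M).ncard = (triplePairs M).ncard := by
    rw [heq, hTfin.ncard_biUnion hfib hdisj, finsum_mem_eq_finite_toFinset_sum _ hTfin]
    rw [Finset.sum_congr rfl (g := fun _ => 3) ?_]
    · rw [Finset.sum_const, smul_eq_mul, ncard_eq_toFinset_card _ hTfin, mul_comm]
    · intro T hT
      rw [Finite.mem_toFinset] at hT
      rw [ncard_prod, ncard_singleton, one_mul, ncard_setOf_subset_ncard_eq (M.ground_finite.subset hT.1) 2,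
        hT.2.1]
      rfl
  -- upper side: the incidences lie over the `15` pairs of `E`, at most `2` per pair
  have hPfin : {P : Set α | P ⊆ M.E ∧ P.ncard = 2}.Finite :=
    M.ground_finite.finite_subsets.subset (fun _ hP => hP.1)
  have hup : triplePairs M ⊆ ⋃ P ∈ {P : Set α | P ⊆ M.E ∧ P.ncard = 2},
      {Q ∈ triplePairs M | Q.2 = P} := by
    rintro ⟨T, P⟩ ⟨hT, hPT, hP2⟩
    rw [mem_iUnion₂]
    exact ⟨P, ⟨hPT.trans hT.1, hP2⟩, ⟨hT, hPT, hP2⟩, rfl⟩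
  have hfibP : ∀ P ∈ {P : Set α | P ⊆ M.E ∧ P.ncard = 2}, {Q ∈ triplePairs M | Q.2 = P}.ncard ≤ 2 := by
    rintro P ⟨hPE, hP2⟩
    obtain ⟨x, y, hxy, rfl⟩ := ncard_eq_two.mp hP2
    have hx : x ∈ M.E := hPE (by simp)
    have hy : y ∈ M.E := hPE (by simp)
    -- the fibre lies in the image of `cl {x, y} ∖ {x, y}` under `z ↦ (insert z {x, y}, {x, y})`
    have hcl := ncard_closure_pair_le_of_coloops hM hcol hpairs hx hy hxy
    rw [hE] at hcl
    have hclE : M.closure {x, y} ⊆ M.E := M.closure_subset_ground _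
    have hsubcl : ({x, y} : Set α) ⊆ M.closure {x, y} := M.subset_closure _ hPE
    have hdiff : (M.closure {x, y} \ {x, y}).ncard ≤ 2 := by
      rw [ncard_sdiff' hsubcl (M.ground_finite.subset hclE), hP2]
      omega
    have hsub : {Q ∈ triplePairs M | Q.2 = {x, y}} ⊆
        (fun z => (insert z {x, y}, ({x, y} : Set α))) '' (M.closure {x, y} \ {x, y}) := by
      rintro ⟨T, P⟩ ⟨⟨⟨hTE, hT3, hT2⟩, hPT, -⟩, hPxy⟩
      have hPxy' : P = {x, y} := hPxy
      subst hPxy'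
      have hTfin : T.Finite := M.ground_finite.subset hTE
      have h1 : (T \ {x, y}).ncard = 1 := by
        rw [ncard_sdiff' hPT hTfin, hT3, hP2]
      obtain ⟨z, hz⟩ := ncard_eq_one.mp h1
      have hzmem : z ∈ T \ {x, y} := by rw [hz]; exact mem_singleton z
      have hTeq : T = insert z {x, y} := by
        ext w
        constructor
        · intro hw
          by_cases hwxy : w ∈ ({x, y} : Set α)
          · exact Or.inr hwxy
          · have : w ∈ T \ {x, y} := ⟨hw, hwxy⟩
            rw [hz] at this
            exact Or.inl this
        · rintro (rfl | hw)
          · exact hzmem.1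
          · exact hPT hw
      refine ⟨z, ⟨?_, hzmem.2⟩, ?_⟩
      · rw [mem_closure_iff_eRk_insert_eq M (hTE hzmem.1) hPE, ← hTeq, hT2, hpairs x hx y hy hxy]
      · simp only [Prod.mk.injEq, and_true]
        exact hTeq.symm
    have hfin' : (M.closure {x, y} \ {x, y}).Finite := (M.ground_finite.subset hclE).subset sdiff_subset
    exact (ncard_le_ncard hsub (hfin'.image _)).trans ((ncard_image_le hfin').trans hdiff)
  -- assemble: `3 · #triples = #incidences ≤ Σ_P 2 = 30`
  have hcardP : {P : Set α | P ⊆ M.E ∧ P.ncard = 2}.ncard = 15 := by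
    rw [ncard_setOf_subset_ncard_eq M.ground_finite 2, hE]
    rfl
  calc 3 * (rankTwoTriples M).ncard = (triplePairs M).ncard := hlow
    _ ≤ (⋃ P ∈ {P : Set α | P ⊆ M.E ∧ P.ncard = 2}, {Q ∈ triplePairs M | Q.2 = P}).ncard :=
        ncard_le_ncard hup (hPfin.biUnion (fun P _ => hQfin.subset (fun Q hQ => hQ.1)))
    _ ≤ ∑ᶠ P ∈ {P : Set α | P ⊆ M.E ∧ P.ncard = 2}, {Q ∈ triplePairs M | Q.2 = P}.ncard :=
        hPfin.ncard_biUnion_le _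
    _ = ∑ P ∈ hPfin.toFinset, {Q ∈ triplePairs M | Q.2 = P}.ncard := finsum_mem_eq_finite_toFinset_sum _ hPfin
    _ ≤ hPfin.toFinset.card • 2 := by
        apply Finset.sum_le_card_nsmul
        intro P hP
        rw [Finite.mem_toFinset] at hP
        exact hfibP P hP
    _ = 2 * 15 := by rw [smul_eq_mul, ← ncard_eq_toFinset_card _ hPfin, hcardP, mul_comm]

/-- `N_M(3, 2) ≤ 15 + #(rank-2 triples)` on `6` points: a spanning set whose complement has rank `2` has `4`
points (complement a pair) or `3` points (complement a rank-`2` triple). -/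
theorem ncard_profileSet_three_two_le_add (hE : M.E.ncard = 6) :
    (profileSet M 3 2).ncard ≤ 15 + (rankTwoTriples M).ncard := by
  have hfin4 : {A : Set α | A ⊆ M.E ∧ A.ncard = 4}.Finite := M.ground_finite.finite_subsets.subset (fun _ hA => hA.1)
  have hsub : profileSet M 3 2 ⊆ {A : Set α | A ⊆ M.E ∧ A.ncard = 4} ∪ (fun T => M.E \ T) '' rankTwoTriples M := by
    rintro A ⟨hAE, hA3, hAc⟩
    have hAfin : A.Finite := M.ground_finite.subset hAE
    have h1 : ((3 : ℕ) : ℕ∞) ≤ (A.ncard : ℕ∞) := by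
      rw [← hA3, hAfin.cast_ncard_eq]; exact M.eRk_le_encard A
    have h2 : ((2 : ℕ) : ℕ∞) ≤ ((M.E \ A).ncard : ℕ∞) := by
      rw [← hAc, (M.ground_finite.subset sdiff_subset).cast_ncard_eq]; exact M.eRk_le_encard _
    have h3 : A.ncard + (M.E \ A).ncard = M.E.ncard := by
      rw [← ncard_union_eq disjoint_sdiff_right hAfin (M.ground_finite.subset sdiff_subset), union_sdiff_cancel hAE]
    have h1' : 3 ≤ A.ncard := by exact_mod_cast h1
    have h2' : 2 ≤ (M.E \ A).ncard := by exact_mod_cast h2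
    rcases Nat.lt_or_ge A.ncard 4 with h | h
    · right
      refine ⟨M.E \ A, ⟨sdiff_subset, by omega, hAc⟩, ?_⟩
      exact sdiff_sdiff_cancel_left hAE
    · left
      exact ⟨hAE, by omega⟩
  have h := ncard_le_ncard hsub (hfin4.union ((rankTwoTriples_finite M).image _))
  refine h.trans ((ncard_union_le _ _).trans ?_)
  rw [ncard_setOf_subset_ncard_eq M.ground_finite 4, hE]
  exact Nat.add_le_add_left (ncard_image_le (rankTwoTriples_finite M)) _

/-- `f(2) + f(3) ≥ 2^|E| − 1 − |E|` when all pairs have rank `2` and the rank is `3`: every set with at least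
two points has rank `2` or `3`. -/
theorem ncard_rankSet_two_add_three_ge_of_pairs (hM : M.eRank = ((3 : ℕ) : ℕ∞))
    (hpairs : ∀ e ∈ M.E, ∀ f ∈ M.E, e ≠ f → M.eRk {e, f} = 2) :
    2 ^ M.E.ncard - 1 - M.E.ncard ≤ (rankSet M 2).ncard + (rankSet M 3).ncard := by
  have hsub : {A : Set α | A ⊆ M.E ∧ 2 ≤ A.ncard} ⊆ rankSet M 2 ∪ rankSet M 3 := by
    rintro A ⟨hAE, h2⟩
    have hlo := two_le_eRk_of_two_le_ncard hpairs hAE h2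
    have hhi := M.eRk_le_eRank A
    rw [hM] at hhi
    obtain ⟨n, hn⟩ := ENat.ne_top_iff_exists.mp (ne_top_of_le_ne_top (by decide) hhi)
    rw [← hn] at hlo hhi
    have hlo' : 2 ≤ n := by exact_mod_cast hlo
    have hhi' : n ≤ 3 := by exact_mod_cast hhi
    have hmem : ∀ k, n = k → A ∈ rankSet M k := fun k hk => ⟨hAE, by rw [← hn, hk]⟩
    rcases Nat.lt_or_ge n 3 with h | h
    · exact Or.inl (hmem 2 (by omega))
    · exact Or.inr (hmem 3 (by omega))
  have h := ncard_le_ncard hsub ((rankSet_finite M 2).union (rankSet_finite M 3))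
  rwa [ncard_setOf_subset_two_le_ncard M.ground_finite,
    ncard_union_eq (rankSet_disjoint_of_ne M (by norm_num)) (rankSet_finite M 2) (rankSet_finite M 3)] at h

/-- `f(3) ≥ 23` for a coloop-free matroid of rank `3` on `6` points with all pairs of rank `2`: the double count
`2 f(2) ≤ 3 f(3)` and `f(2) + f(3) ≥ 57`. -/
theorem ncard_rankSet_three_ge_of_pairs (hM : M.eRank = ((3 : ℕ) : ℕ∞)) (hcol : M.coloops = ∅)
    (hpairs : ∀ e ∈ M.E, ∀ f ∈ M.E, e ≠ f → M.eRk {e, f} = 2) (hE : M.E.ncard = 6) :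
    23 ≤ (rankSet M 3).ncard := by
  have hM' : M.eRank = ((2 + 1 : ℕ) : ℕ∞) := hM
  have hdc : 2 * (rankSet M 2).ncard ≤ 3 * (rankSet M 3).ncard := two_mul_ncard_rankSet_le M hM' hcol
  have hsum := ncard_rankSet_two_add_three_ge_of_pairs hM hpairs
  rw [hE] at hsum
  have h64 : 2 ^ 6 - 1 - 6 = 57 := by decide
  rw [h64] at hsum
  omega

end RankThreeOnSix

end S1

end PercRepro
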